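import Literature.AlgebraicGeometry.Resolution.DerivativeIdealsBlowup
import HarnessLib

/-!
# Persistence of hypersurfaces of maximal contact under blow-ups (BGMW 2011, Lemma 3.6.4 (2), (3), (5); Lemma 3.6.6, weak form)

Topic: `Literature/AlgebraicGeometry/Resolution`. Bierstone–Grigoriev–Milman–Włodarczyk,
*Effective Hironaka resolution and its complexity (with appendix on applications in positive
characteristic)*, arXiv:1206.3090, §3.6 (p. 8, arXiv numbering):

  **Lemma 3.6.4** (Giraud). "Let `(𝓘, μ)` be a marked ideal of maximal order. Let `σ : X ← X'`
  be a blow-up at a smooth center `C ⊂ supp(𝓘, μ)`. Let `u ∈ 𝒟^{μ-1}(𝓘, μ)(U)` be a function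
  such that, for any `x ∈ V(u)`, `ord_x(u) = 1`. Then (1) `V(u)` is smooth; (2)
  `supp(𝓘, μ) ∩ U ⊂ V(u)`. Let `U' ⊂ σ⁻¹(U) ⊂ X'` be an open set where the exceptional divisor is
  described by `y`. Let `u' := σᶜ(u) = y⁻¹σ^*(u)` be the controlled transform of `u`. Then (3)
  `u' ∈ 𝒟^{μ-1}(σᶜ(𝓘|U', μ))`; (4) `V(u')` is smooth; (5) `supp(𝓘', μ) ∩ U' ⊂ V(u')`; (6) `V(u')`
  is the restriction of the strict transform of `V(u)` to `U'`."

  **Lemma 3.6.6** (Giraud). "Let `u ∈ T(𝓘)(U)` be a tangent direction of `(𝓘, μ)` on `U`. Then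
  for any multiple blow-up `(U_i)` of `(𝓘|U, μ)`, all the supports of the induced marked ideals
  `supp(𝓘_i, μ)` are contained in the strict transforms `V(u)_i` of `V(u)`."

This file PROVES, at the level of ideal sheaves and for blow-ups in the sense of the universal
property (`IsBlowup`, `IsMultipleBlowup`), the parts of these statements that do not involve the
smoothness of the hypersurface: for an ideal sheaf `H ⊆ T(𝓘) := 𝒟^{μ-1}(𝓘)` (the ideal of the
hypersurface, locally `(u)` with `u ∈ T(𝓘)(U)`), `μ ≥ 1`:

* (2) `supp(𝓘, μ) ⊆ V(H)` — in EVERY characteristic and without the maximal-order hypothesis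
  (`supp(𝓘, μ) ⊆ supp(𝒟^{μ-1}𝓘, 1) = V(𝒟^{μ-1}𝓘) ⊆ V(H)`, the characteristic-free inclusion of
  Lemma 3.5.2, `MarkedIdeal.support_subset_support_deriv`): `MarkedIdeal.support_subset_support_of_le_deriv`;
* (3) the controlled transform `H' := (σ^*H : 𝓘(D))` (`controlledTransform σ C H 1`; locally
  `(u')`, `u' = y⁻¹σ^*u`) lies in `T(𝓘') = 𝒟^{μ-1}(σᶜ(𝓘, μ))` — by Lemma 3.5.3 with `r = μ - 1`
  (`IsBlowup.controlledTransform_derivIdealSheafIter_le`, `DerivativeIdealsBlowup.lean`):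
  `IsBlowup.controlledTransform_le_derivIdealSheafIter_transform` and its marked form
  `IsBlowup.transform_hypersurface_le`;
* (5) `supp(𝓘', μ) ⊆ V(H')`: `IsBlowup.support_transform_subset`; and `V` of the strict
  transform of `H` contains `V(H')` ⊇ `supp(𝓘', μ)` (`support_strictTransformIdeal_subset`) — the
  inclusion half of (6);
* Lemma 3.6.6 in the corresponding form along a multiple blow-up
  (`IsMultipleBlowup.exists_hypersurface`, `IsMultipleBlowup.support_subset_preimage_support`):
  there is an ideal sheaf `H_i` on `X_i` with `σ^*H ⊆ H_i ⊆ T(𝓘_i)` (the iterated controlled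
  transform), so `supp(𝓘_i, μ) ⊆ V(H_i) ⊆ σ⁻¹V(H)`.

NOT treated here (they need the chart identity `R[P/y]/(u/y) ≅ (R/u)[P̄/ȳ]`, i.e. "strict
transform of the hypersurface = blow-up of the hypersurface"): (1)/(4) smoothness of `V(u)`,
`V(u')` (for (1) see `MaximalContact.lean`) and the equality in (6); accordingly Lemma 3.6.6 is
rendered with the TOTAL transform `σ⁻¹V(H)` and the intermediate ideals `H_i ⊆ T(𝓘_i)` instead of
the strict transforms `V(u)_i` — weaker than printed.

## Sources

* [BGMW 2011] §3.6: Lemma 3.6.4, Def. 3.6.5, Lemma 3.6.6; §3.5: Lemma 3.5.2, Lemma 3.5.3;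
  §3.2 Lemma 3.2.1 (arXiv:1206.3090, pp. 7–8). [BierstoneGrigorievMilmanWlodarczyk2011]
-/

noncomputable section

open CategoryTheory CategoryTheory.Limits AlgebraicGeometry TopologicalSpace

namespace Literature.AlgebraicGeometry.Resolution

universe u v

/-! ## Lemma 3.6.4 (2): the support lies on every hypersurface `V(H)`, `H ⊆ T(𝓘)` -/

section Static

variable {k : Type v} [CommRing k] {X : Scheme.{u}} {φ : k →+* Γ(X, ⊤)}

/-- **BGMW Lemma 3.6.4 (2), sheaf form** ("`supp(𝓘, μ) ∩ U ⊂ V(u)`" for `u ∈ 𝒟^{μ-1}(𝓘)(U)`): for a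
marked ideal `(𝓘, μ)` with `μ ≥ 1` and an ideal sheaf `H ⊆ T(𝓘) = 𝒟^{μ-1}(𝓘)`,
`supp(𝓘, μ) ⊆ V(H)`. Holds in every characteristic and without the maximal-order hypothesis:
`supp(𝓘, μ) ⊆ supp(𝒟^{μ-1}𝓘, 1) = V(𝒟^{μ-1}𝓘) ⊆ V(H)` (Lemma 3.5.2, inclusion).
[cite: BierstoneGrigorievMilmanWlodarczyk2011, Lemma 3.6.4 (2)] -/
theorem MarkedIdeal.support_subset_support_of_le_deriv (hX : HasFinitePresentationDifferentials φ)
    (M : MarkedIdeal X) (hμ : 1 ≤ M.mult) {H : X.IdealSheafData}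
    (hH : H ≤ derivIdealSheafIter φ (M.mult - 1) M.ideal) : M.support ⊆ (H.support : Set X) := by
  have h1 : M.support ⊆ (M.deriv φ (M.mult - 1)).support := M.support_subset_support_deriv hX _
  have h2 : (M.deriv φ (M.mult - 1)).support =
      ((derivIdealSheafIter φ (M.mult - 1) M.ideal).support : Set X) :=
    (M.deriv φ (M.mult - 1)).support_of_mult_eq_one (by simp; omega)
  rw [h2] at h1
  exact h1.trans (Scheme.IdealSheafData.support_antitone hH)

end Static

/-! ## Lemma 3.6.4 (3), (5): the controlled transform of the hypersurface -/

section Blowup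

variable {k : Type v} [CommRing k] {X X' : Scheme.{u}} [IsLocallyNoetherian X'] {φ : k →+* Γ(X, ⊤)}
  {π : X' ⟶ X} {C : X.IdealSheafData}

omit [IsLocallyNoetherian X'] in
/-- The controlled transform is monotone in the ideal sheaf. [folklore] -/
theorem controlledTransform_mono {H L : X.IdealSheafData} (h : H ≤ L) (ν : ℕ) :
    controlledTransform π C H ν ≤ controlledTransform π C L ν :=
  colon_mono_left (Scheme.IdealSheafData.comap_mono (f := π) h) _

/-- **BGMW Lemma 3.6.4 (3), sheaf form** ("`u' = σᶜ(u) = u/y ∈ σᶜ(𝒟^{μ-1}(𝓘)) ⊂ 𝒟^{μ-1}(σᶜ(𝓘))`"):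
for a blow-up `π` along `C`, an ideal sheaf `𝓘 ⊆ C^μ` (`μ ≥ 1`) and `H ⊆ 𝒟^{μ-1}(𝓘)`, the
controlled transform `H' = (π^*H : 𝓘(D))` of `(H, 1)` lies in `𝒟^{μ-1}` of the controlled
transform `(π^*𝓘 : 𝓘(D)^μ)` of `(𝓘, μ)` (Lemma 3.5.3 with `r = μ - 1`). Every characteristic.
[cite: BierstoneGrigorievMilmanWlodarczyk2011, Lemma 3.6.4 (3)] -/
theorem IsBlowup.controlledTransform_le_derivIdealSheafIter_transform
    (hX : HasFinitePresentationDifferentials φ)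
    (hX' : HasFinitePresentationDifferentials (π.appTop.hom.comp φ)) (hπ : IsBlowup π C)
    {I H : X.IdealSheafData} {μ : ℕ} (hμ : 1 ≤ μ) (hI : I ≤ C ^ μ)
    (hH : H ≤ derivIdealSheafIter φ (μ - 1) I) :
    controlledTransform π C H 1 ≤
      derivIdealSheafIter (π.appTop.hom.comp φ) (μ - 1) (controlledTransform π C I μ) := by
  have h := hπ.controlledTransform_derivIdealSheafIter_le hX hX' hI (Nat.sub_le μ 1)
  rw [show μ - (μ - 1) = 1 by omega] at h
  exact (controlledTransform_mono hH 1).trans h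

/-- **BGMW Lemma 3.6.4 (3) for marked ideals**: for an admissible centre `C` of
`M = (𝓘, E, μ)`, `μ ≥ 1`, a blow-up `π` along `C` and `H ⊆ T(𝓘) = 𝒟^{μ-1}(𝓘)`, the transform
`H' = (π^*H : 𝓘(D))` satisfies `H' ⊆ T(𝓘') = 𝒟^{μ-1}(𝓘')`, `𝓘'` the ideal of the transform `M'`.
[cite: BierstoneGrigorievMilmanWlodarczyk2011, Lemma 3.6.4 (3)] -/
theorem IsBlowup.transform_hypersurface_le (hX : HasFinitePresentationDifferentials φ)
    (hX' : HasFinitePresentationDifferentials (π.appTop.hom.comp φ)) (hπ : IsBlowup π C)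
    (M : MarkedIdeal X) (hμ : 1 ≤ M.mult) (hsupp : (C.support : Set X) ⊆ M.support)
    (hsnc : HasSNCWith M.boundary C) {H : X.IdealSheafData}
    (hH : H ≤ derivIdealSheafIter φ (M.mult - 1) M.ideal) :
    controlledTransform π C H 1 ≤
      derivIdealSheafIter (π.appTop.hom.comp φ) ((M.transform π C).mult - 1) (M.transform π C).ideal := by
  rw [MarkedIdeal.transform_mult, MarkedIdeal.transform_ideal]
  exact hπ.controlledTransform_le_derivIdealSheafIter_transform hX hX' hμ
    (M.ideal_le_pow hsupp hsnc) hH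

/-- **BGMW Lemma 3.6.4 (5), sheaf form** ("`supp(𝓘', μ) ∩ U' ⊂ V(u')`"): with notation as in
`IsBlowup.transform_hypersurface_le`, the support of the transform `M'` lies on `V(H')`,
`H' = (π^*H : 𝓘(D))` the controlled transform of the hypersurface ideal. Every characteristic.
[cite: BierstoneGrigorievMilmanWlodarczyk2011, Lemma 3.6.4 (5)] -/
theorem IsBlowup.support_transform_subset (hX : HasFinitePresentationDifferentials φ)
    (hX' : HasFinitePresentationDifferentials (π.appTop.hom.comp φ)) (hπ : IsBlowup π C)
    (M : MarkedIdeal X) (hμ : 1 ≤ M.mult) (hsupp : (C.support : Set X) ⊆ M.support)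
    (hsnc : HasSNCWith M.boundary C) {H : X.IdealSheafData}
    (hH : H ≤ derivIdealSheafIter φ (M.mult - 1) M.ideal) :
    (M.transform π C).support ⊆ ((controlledTransform π C H 1).support : Set X') :=
  (M.transform π C).support_subset_support_of_le_deriv hX' (by simpa using hμ)
    (hπ.transform_hypersurface_le hX hX' M hμ hsupp hsnc hH)

omit [IsLocallyNoetherian X'] in
/-- The inclusion half of **Lemma 3.6.4 (6)**: `V` of the strict transform of the hypersurface
ideal `H` is contained in `V(H')`, `H' = (π^*H : 𝓘(D)) ⊆ ⋃ₙ (π^*H : 𝓘(D)ⁿ)`.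
[cite: BierstoneGrigorievMilmanWlodarczyk2011, Lemma 3.6.4 (6)] -/
theorem support_strictTransformIdeal_subset (H : X.IdealSheafData) :
    ((strictTransformIdeal π C H).support : Set X') ⊆ (controlledTransform π C H 1).support :=
  Scheme.IdealSheafData.support_antitone (controlledTransform_le_strictTransformIdeal π C H 1)

omit [IsLocallyNoetherian X'] in
/-- `V(H') ⊆ π⁻¹ V(H)`: the controlled transform contains the total transform. [folklore] -/
theorem support_controlledTransform_subset_preimage (H : X.IdealSheafData) (ν : ℕ) :
    ((controlledTransform π C H ν).support : Set X') ⊆ π ⁻¹' H.support := by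
  intro x hx
  have hx' := Scheme.IdealSheafData.support_antitone (comap_le_controlledTransform π C H ν) hx
  rwa [Scheme.IdealSheafData.support_comap] at hx'

end Blowup

/-! ## Lemma 3.6.6 (Giraud), weak form, along a multiple blow-up -/

section Multiple

variable (k : Type u) [Field k] {X X' : Scheme.{u}} [X.Over (Spec (.of k))]
  [LocallyOfFiniteType (X ↘ Spec (.of k))] [IsLocallyNoetherian X]

/-- **BGMW Lemma 3.6.6 (Giraud), weak sheaf form along a multiple blow-up**: over a field `k`,
for `X` locally Noetherian and locally of finite type over `Spec k`, a marked ideal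
`M = (𝓘, E, μ)` with `μ ≥ 1`, an ideal sheaf `H ⊆ T(𝓘) = 𝒟^{μ-1}(𝓘)` (the ideal of a
hypersurface of maximal contact) and any multiple blow-up `σ : X' → X` of `M` with final marked
ideal `M' = (𝓘', E', μ)`, there is an ideal sheaf `H'` on `X'` — the iterated controlled transform
of `H` — with `σ^*H ⊆ H' ⊆ T(𝓘') = 𝒟^{μ-1}(𝓘')` (for the induced `k`-structure). Printed:
"all the supports of the induced marked ideals `supp(𝓘_i, μ)` are contained in the strict
transforms `V(u)_i` of `V(u)`"; here `V(H') ⊇ supp(𝓘', μ)` replaces the strict transform (see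
`IsMultipleBlowup.support_subset_support_and_preimage`). No maximal-order or characteristic
hypothesis is needed for this form. [cite: BierstoneGrigorievMilmanWlodarczyk2011, Lemma 3.6.6] -/
theorem IsMultipleBlowup.exists_hypersurface {M : MarkedIdeal X} {σ : X' ⟶ X}
    {M' : MarkedIdeal X'} (h : IsMultipleBlowup M σ M') (hμ : 1 ≤ M.mult) {H : X.IdealSheafData}
    (hH : H ≤ derivIdealSheafIter (overHom k X) (M.mult - 1) M.ideal) :
    ∃ H' : X'.IdealSheafData, H.comap σ ≤ H' ∧ M'.mult = M.mult ∧
      H' ≤ derivIdealSheafIter (σ.appTop.hom.comp (overHom k X)) (M'.mult - 1) M'.ideal := by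
  induction h with
  | refl => exact ⟨H, by rw [Scheme.IdealSheafData.comap_id], rfl, by rwa [id_appTop_comp]⟩
  | @blowup X' X'' σ M' h C τ hτ hC hsupp hsnc ih =>
    obtain ⟨H₁, hHH₁, hmult, hH₁⟩ := ih
    haveI := h.isLocallyNoetherian
    haveI : IsProper σ := h.isProper
    haveI : IsProper τ := hτ.isProper
    haveI : IsLocallyNoetherian X'' := LocallyOfFiniteType.isLocallyNoetherian τ
    have hX' := hasFinitePresentationDifferentials_appTop_comp_overHom k σ
    have hX'' : HasFinitePresentationDifferentials (τ.appTop.hom.comp (σ.appTop.hom.comp (overHom k X))) := by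
      rw [← comp_appTop_comp]
      exact hasFinitePresentationDifferentials_appTop_comp_overHom k (τ ≫ σ)
    refine ⟨controlledTransform τ C H₁ 1, ?_, by simpa using hmult, ?_⟩
    · rw [Scheme.IdealSheafData.comap_comp]
      exact (Scheme.IdealSheafData.comap_mono (f := τ) hHH₁).trans
        (comap_le_controlledTransform τ C H₁ 1)
    · rw [comp_appTop_comp]
      exact hτ.transform_hypersurface_le hX' hX'' M' (by omega) hsupp hsnc hH₁

/-- **BGMW Lemma 3.6.6, weak form: the supports stay on the transforms of the hypersurface** —
with notation as in `IsMultipleBlowup.exists_hypersurface`, `supp(𝓘', μ) ⊆ V(H') ⊆ σ⁻¹V(H)`.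
[cite: BierstoneGrigorievMilmanWlodarczyk2011, Lemma 3.6.6] -/
theorem IsMultipleBlowup.support_subset_support_and_preimage {M : MarkedIdeal X} {σ : X' ⟶ X}
    {M' : MarkedIdeal X'} (h : IsMultipleBlowup M σ M') (hμ : 1 ≤ M.mult) {H : X.IdealSheafData}
    (hH : H ≤ derivIdealSheafIter (overHom k X) (M.mult - 1) M.ideal) :
    ∃ H' : X'.IdealSheafData, H.comap σ ≤ H' ∧
      H' ≤ derivIdealSheafIter (σ.appTop.hom.comp (overHom k X)) (M'.mult - 1) M'.ideal ∧
      M'.support ⊆ (H'.support : Set X') ∧ (H'.support : Set X') ⊆ σ ⁻¹' H.support := by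
  obtain ⟨H', hHH', hmult, hH'⟩ := h.exists_hypersurface k hμ hH
  haveI : IsProper σ := h.isProper
  have hX' := hasFinitePresentationDifferentials_appTop_comp_overHom k σ
  refine ⟨H', hHH', hH', M'.support_subset_support_of_le_deriv hX' (by omega) hH', ?_⟩
  intro x hx
  have hx' := Scheme.IdealSheafData.support_antitone hHH' hx
  rwa [Scheme.IdealSheafData.support_comap] at hx'

end Multiple

end Literature.AlgebraicGeometry.Resolution

end
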